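import Summits.CriticalPhenomena.PercolationContinuityZ3.Theorems.PercNearOneGluingNoHeavyLowerTailFrontierDecRowsEdgeInduction
import Summits.CriticalPhenomena.PercolationContinuityZ3.Theorems.PercNearOneGluingNoHeavyLowerTailE3GroupSepLeFive
import HarnessLib

/-!
# The TERMINAL-EDGE induction schema for Sahi's `E₃` of pattern events:
# polarised Bernstein coefficients `≥ 0` at TERMINAL-INCIDENT edges (given the induction hypotheses) ⇒ `E₃ ≥ 0` on every finite weighted graph

Support file (prover seat `prim-bnk-1`, gen 8; `--supports stmt-CriticalPhenomena-4575`).  No named facts, no sorries, no `native_decide`;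
bookkeeping definitions `IsLocal`, `oneCfg`, `good`, `Touch`, `frac` and the hypothesis package `TerminalEdgeHyp`.

CONTEXT.  `…FrontierDecRowsEdgeInduction` (prim-l12-p1 gen 3) proves the ALL-EDGES schema `EdgeInduction.sahiE3_nonneg_of_edgeBernstein`:
if both mixed Bernstein coefficients `polar₁ μ_{w[e↦0]} μ_{w[e↦1]}`, `polar₁ μ_{w[e↦1]} μ_{w[e↦0]}` of `E₃(A,B,C)` are `≥ 0` for EVERY edge `e`,
then `E₃(A,B,C) ≥ 0` for every weight function.  For the seven open four-point decreasing frontier rows (12, 15, 27, 30, 36 = PATH, 37, 44 of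
`…FrontierDecRowsLeFive`) the edges AWAY from the terminals are the obstacle: their polarised forms live on six-point laws.  The refinement
proved here (prim-l12-p1's memo run/shared/lean/prim/prim-l12/FROM-prim-l12-p1-g3-FREE-VERTEX-SPLIT.md, addendum 10:15Z, there on paper) needs
the hypotheses ONLY AT EDGES INCIDENT TO A TERMINAL — for `k = 4` terminals these are cubic forms in ONE five-point pattern law (52 cells;
`…FrontierDecRowsTerminalEdgeStep` rewrites them under one law) — and it hands the induction hypotheses to the step.

SETTING.  `n` vertices, `k` terminals placed by an injective MARKING `x : Fin k → Fin n`; three marking-indexed event families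
`E₁ E₂ E₃ : (Fin k → Fin n) → Set (BondConfig (Fin n))` that are LOCAL (`IsLocal`: membership of `ω` depends only on the connectivity
pattern `(i,j) ↦ [x i ↔ x j]` of the terminals in `ω`; e.g. every `connEvent` of a pattern predicate, `isLocal_connEvent`, and every group
separation `D[X|Y]` with `X, Y` sub-lists of the terminals, `isLocal_sep`).

**Theorem (`sahiE3_nonneg_of_terminalEdgeHyp`).**  Assume `TerminalEdgeHyp E₁ E₂ E₃`: for every `w`, every injective marking `x`, every
terminal `i` and vertex `u ≠ x i`, with `e = s(x i, u)`: IF `0 ≤ E₃(E₁ x', E₂ x', E₃ x')` under `prodBernoulli w[e↦0]` and under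
`prodBernoulli w[e↦1]` for all injective `x'` (induction hypotheses), THEN `0 ≤ polar₁ μ_{w[e↦0]} μ_{w[e↦1]} (E₁ x) (E₂ x) (E₃ x)` and
`0 ≤ polar₁ μ_{w[e↦1]} μ_{w[e↦0]} (E₁ x) (E₂ x) (E₃ x)`.  Then `0 ≤ E₃(E₁ x, E₂ x, E₃ x)` under `prodBernoulli w` for EVERY `w` and every
injective `x`.
PROOF (induction on the number of non-diagonal edges `e` with `0 < w e < 1`, `frac w`).  Almost surely every weight-one edge is open and every
weight-zero edge is closed (`ae_good`).  (i) If some fractional edge `zu` has an end `z` in the weight-one component of a terminal `x i`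
(`Touch w x`): when `z` is not itself a terminal, RE-MARK `i ↦ z` — the marking `x[i ↦ z]` is injective and has almost surely the same
connectivity pattern as `x` (`z ↔ x i` a.s.), so by locality `E₃` is unchanged (`sahiE3_remark`); now `zu` is incident to the terminal `z`,
`E₃` is a Bernstein cubic in `w(zu)` (`EdgeInduction.sahiE3_oneBond`) whose extreme coefficients are `E₃` under `w[zu↦0], w[zu↦1]` (induction
hypotheses: one fractional edge fewer, `card_frac_update_lt`) and whose mixed coefficients are the terminal-edge hypotheses.  (ii) Otherwise
every edge leaving the weight-one components of the terminals has weight `0` or `1`, so almost surely the open cluster of each terminal IS its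
weight-one component (`reachable_iff_of_not_touch`), the pattern is deterministic, each `Eⱼ x` is almost surely constant and `E₃ = 0`
(`sahiE3_eq_zero_of_not_touch`).  ∎
REMARKS.  (1) Only injective markings occur (degenerate markings of a four-point row are three-point rows, to be quoted from their own theorems).
(2) The statement is about ARBITRARY local families, decreasing or not (increasing rows `U[X|Y]`, γ, … included).  (3) Pattern-predicate form:
`sahiE3_pattern_nonneg_of_terminalEdgeHyp`; the 45 frontier rows and the one-law form of the hypotheses: `…FrontierDecRowsTerminalEdgeStep`.
-/

noncomputable section

namespace Summit.CriticalPhenomena.PercolationContinuityZ3.Theorems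

namespace TerminalEdgeInduction

open MeasureTheory Literature.Probability.Percolation Literature.Probability.LatticeModels
open EdgeInduction CovTransferCert E3GroupSepCert
open scoped Classical

variable {n k : ℕ}

/-! ### Local (pattern-determined) marking-indexed events -/

/-- A marking-indexed family of events `E x` (`x : Fin k → Fin n` the positions of `k` terminals) is LOCAL if membership
`ω ∈ E x` depends only on the connectivity pattern `(i, j) ↦ [x i ↔ x j in ω]` of the terminals. [this work] -/
def IsLocal (E : (Fin k → Fin n) → Set (BondConfig (Fin n))) : Prop :=
  ∀ ⦃ω ω' : BondConfig (Fin n)⦄ ⦃x x' : Fin k → Fin n⦄,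
    (∀ i j, (ω ∈ openConn (x i) (x j) ↔ ω' ∈ openConn (x' i) (x' j))) → (ω ∈ E x ↔ ω' ∈ E x')

/-- Locality is invariant under pointwise equality of families. [this work] -/
theorem IsLocal.of_eq {E F : (Fin k → Fin n) → Set (BondConfig (Fin n))} (hF : IsLocal F) (h : ∀ x, E x = F x) :
    IsLocal E := by
  intro ω ω' x x' hp
  rw [h x, h x']
  exact hF hp

/-- The event of a `k`-terminal pattern predicate `Φ` (a Boolean function of the `k × k` connectivity matrix of the terminals),
read at the marking `x`, is local. [this work] -/
theorem isLocal_connEvent (Φ : (Fin k → Fin k → Bool) → Bool) :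
    IsLocal (fun x : Fin k → Fin n => connEvent (fun r => Φ (fun i j => r (x i) (x j)))) := by
  intro ω ω' x x' h
  simp only [connEvent, Set.mem_setOf_eq]
  have hm : (fun i j => decide (ω ∈ openConn (x i) (x j))) = (fun i j => decide (ω' ∈ openConn (x' i) (x' j))) := by
    funext i j
    exact Bool.decide_congr (h i j)
  rw [hm]

/-- Group-separation events `D[X|Y]` with `X, Y` sub-lists of the terminals are local. [this work] -/
theorem isLocal_sep (I J : List (Fin k)) :
    IsLocal (fun x : Fin k → Fin n => connEvent (sep (I.map x) (J.map x))) := by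
  intro ω ω' x x' h
  simp only [connEvent_sep, Set.mem_setOf_eq, List.forall_mem_map]
  exact forall_congr' fun i => forall_congr' fun _ => forall_congr' fun j => forall_congr' fun _ => not_congr (h i j)

/-! ### Almost-sure structure of `prodBernoulli w`: weight-one edges are open, weight-zero edges are closed -/

/-- The configuration of the weight-one edges. [this work] -/
def oneCfg (w : Sym2 (Fin n) → unitInterval) : BondConfig (Fin n) := {e | w e = 1}

/-- The almost-sure event "every weight-one edge is open and every weight-zero edge is closed". [this work] -/
def good (w : Sym2 (Fin n) → unitInterval) : Set (BondConfig (Fin n)) :=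
  {ω | ∀ e, (w e = 1 → e ∈ ω) ∧ (w e = 0 → e ∉ ω)}

/-- `good w` has full measure under `prodBernoulli w`. [folklore] -/
theorem ae_good (w : Sym2 (Fin n) → unitInterval) : ∀ᵐ ω ∂(prodBernoulli w), ω ∈ good w := by
  have h1 : ∀ e : Sym2 (Fin n), ∀ᵐ ω ∂(prodBernoulli w), (w e = 1 → e ∈ ω) ∧ (w e = 0 → e ∉ ω) := by
    intro e
    refine Filter.Eventually.and ?_ ?_
    · by_cases he : w e = 1
      · have h0 : prodBernoulli w {ω : BondConfig (Fin n) | e ∉ ω} = 0 := by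
          rw [← measureReal_eq_zero_iff (measure_ne_top _ _), prodBernoulli_real_setOf_notMem, he]
          simp
        filter_upwards [measure_eq_zero_iff_ae_notMem.1 h0] with ω hω
        intro _
        simpa using hω
      · exact ae_of_all _ fun ω h => absurd h he
    · by_cases he : w e = 0
      · have h0 : prodBernoulli w {ω : BondConfig (Fin n) | e ∈ ω} = 0 := by
          rw [← measureReal_eq_zero_iff (measure_ne_top _ _), prodBernoulli_real_setOf_mem, he]
          simp
        filter_upwards [measure_eq_zero_iff_ae_notMem.1 h0] with ω hω
        intro _
        simpa using hω
      · exact ae_of_all _ fun ω h => absurd h he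
  filter_upwards [ae_all_iff.2 h1] with ω hω
  exact hω

/-- On `good w` the weight-one graph is an open subgraph: weight-one reachability implies open reachability. [folklore] -/
theorem reachable_of_good {w : Sym2 (Fin n) → unitInterval} {ω : BondConfig (Fin n)} (hω : ω ∈ good w) {u v : Fin n}
    (h : (openGraph (oneCfg w)).Reachable u v) : (openGraph ω).Reachable u v :=
  h.mono (SimpleGraph.fromEdgeSet_mono fun e he => (hω e).1 he)

/-- Every weight is `0`, `1`, or strictly in between. [folklore] -/
theorem weight_trichotomy (w : Sym2 (Fin n) → unitInterval) (e : Sym2 (Fin n)) :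
    w e = 0 ∨ w e = 1 ∨ ((0 : ℝ) < w e ∧ (w e : ℝ) < 1) := by
  have h0 : (0 : ℝ) ≤ w e := (w e).2.1
  have h1 : (w e : ℝ) ≤ 1 := (w e).2.2
  rcases h0.eq_or_lt with h | h
  · left; exact Subtype.ext h.symm
  · rcases h1.eq_or_lt with h' | h'
    · right; left; exact Subtype.ext h'
    · right; right; exact ⟨h, h'⟩

/-- "Some fractional edge touches the weight-one component of a terminal": there are `z, u` with `z` joined to a terminal by
weight-one edges, `z ≠ u`, and `0 < w(zu) < 1`. [this work] -/
def Touch (w : Sym2 (Fin n) → unitInterval) (x : Fin k → Fin n) : Prop :=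
  ∃ z u : Fin n, (∃ i, (openGraph (oneCfg w)).Reachable (x i) z) ∧ z ≠ u ∧ (0 : ℝ) < w s(z, u) ∧ (w s(z, u) : ℝ) < 1

/-- If NO fractional edge touches the weight-one components of the terminals, then almost surely the open cluster of every terminal
IS its weight-one component: open reachability from a terminal coincides with weight-one reachability. [this work] -/
theorem reachable_iff_of_not_touch {w : Sym2 (Fin n) → unitInterval} {x : Fin k → Fin n} (hB : ¬ Touch w x)
    {ω : BondConfig (Fin n)} (hω : ω ∈ good w) (i : Fin k) (v : Fin n) :
    (openGraph ω).Reachable (x i) v ↔ (openGraph (oneCfg w)).Reachable (x i) v := by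
  refine ⟨fun h => ?_, reachable_of_good hω⟩
  rw [SimpleGraph.reachable_iff_reflTransGen] at h
  induction h with
  | refl => exact SimpleGraph.Reachable.refl _
  | @tail b c _ hbc ih =>
      rw [openGraph_adj] at hbc
      obtain ⟨hmem, hne⟩ := hbc
      rcases weight_trichotomy w s(b, c) with h0 | h1 | hf
      · exact absurd hmem ((hω _).2 h0)
      · refine ih.trans (SimpleGraph.Adj.reachable ?_)
        rw [openGraph_adj]
        exact ⟨h1, hne⟩
      · exact absurd ⟨b, c, ⟨i, ih⟩, hne, hf⟩ hB

/-! ### `E₃` under almost-sure modifications of the events -/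

/-- `E₃` only depends on the events up to null sets. [folklore] -/
theorem sahiE3_congr_ae {μ : Measure (BondConfig (Fin n))} {A A' B B' C C' : Set (BondConfig (Fin n))}
    (hA : A =ᵐ[μ] A') (hB : B =ᵐ[μ] B') (hC : C =ᵐ[μ] C') : sahiE3 μ A B C = sahiE3 μ A' B' C' := by
  simp only [sahiE3]
  rw [measureReal_congr hA, measureReal_congr hB, measureReal_congr hC, measureReal_congr ((hA.inter hB).inter hC),
    measureReal_congr (hB.inter hC), measureReal_congr (hA.inter hC), measureReal_congr (hA.inter hB)]

/-- `E₃` of three almost surely constant events vanishes (probability measure). [folklore] -/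
theorem sahiE3_eq_zero_of_ae_const {μ : Measure (BondConfig (Fin n))} [IsProbabilityMeasure μ]
    {A B C : Set (BondConfig (Fin n))} {a b c : Prop} (hA : ∀ᵐ ω ∂μ, ω ∈ A ↔ a) (hB : ∀ᵐ ω ∂μ, ω ∈ B ↔ b)
    (hC : ∀ᵐ ω ∂μ, ω ∈ C ↔ c) : sahiE3 μ A B C = 0 := by
  have key : ∀ (S : Set (BondConfig (Fin n))) (s : Prop), (∀ᵐ ω ∂μ, ω ∈ S ↔ s) → μ.real S = if s then 1 else 0 := by
    intro S s h
    by_cases hs : s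
    · rw [if_pos hs]
      have hS : S =ᵐ[μ] (Set.univ : Set (BondConfig (Fin n))) :=
        Filter.eventuallyEq_set.2 (by filter_upwards [h] with ω hω; simp [hω, hs])
      rw [measureReal_congr hS, probReal_univ]
    · rw [if_neg hs]
      have hS : S =ᵐ[μ] (∅ : Set (BondConfig (Fin n))) :=
        Filter.eventuallyEq_set.2 (by filter_upwards [h] with ω hω; simp [hω, hs])
      rw [measureReal_congr hS, measureReal_empty]
  have hABC : ∀ᵐ ω ∂μ, ω ∈ A ∩ B ∩ C ↔ (a ∧ b) ∧ c := by
    filter_upwards [hA, hB, hC] with ω h1 h2 h3; simp only [Set.mem_inter_iff, h1, h2, h3]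
  have hBC : ∀ᵐ ω ∂μ, ω ∈ B ∩ C ↔ b ∧ c := by
    filter_upwards [hB, hC] with ω h2 h3; simp only [Set.mem_inter_iff, h2, h3]
  have hAC : ∀ᵐ ω ∂μ, ω ∈ A ∩ C ↔ a ∧ c := by
    filter_upwards [hA, hC] with ω h1 h3; simp only [Set.mem_inter_iff, h1, h3]
  have hAB : ∀ᵐ ω ∂μ, ω ∈ A ∩ B ↔ a ∧ b := by
    filter_upwards [hA, hB] with ω h1 h2; simp only [Set.mem_inter_iff, h1, h2]
  simp only [sahiE3]
  rw [key _ _ hA, key _ _ hB, key _ _ hC, key _ _ hABC, key _ _ hBC, key _ _ hAC, key _ _ hAB]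
  by_cases ha : a <;> by_cases hb : b <;> by_cases hc : c <;> norm_num [ha, hb, hc]

variable {E₁ E₂ E₃ : (Fin k → Fin n) → Set (BondConfig (Fin n))}

/-- **Deterministic case.**  If no fractional edge touches the weight-one components of the terminals, `E₃` of three local events
vanishes: each of them is almost surely decided by the weight-one pattern. [this work] -/
theorem sahiE3_eq_zero_of_not_touch (hE₁ : IsLocal E₁) (hE₂ : IsLocal E₂) (hE₃ : IsLocal E₃)
    (w : Sym2 (Fin n) → unitInterval) (x : Fin k → Fin n) (hB : ¬ Touch w x) :
    sahiE3 (prodBernoulli w) (E₁ x) (E₂ x) (E₃ x) = 0 := by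
  have pat : ∀ᵐ ω ∂(prodBernoulli w), ∀ i j, (ω ∈ openConn (x i) (x j) ↔ oneCfg w ∈ openConn (x i) (x j)) := by
    filter_upwards [ae_good w] with ω hω
    intro i j
    exact reachable_iff_of_not_touch hB hω i (x j)
  refine sahiE3_eq_zero_of_ae_const (a := oneCfg w ∈ E₁ x) (b := oneCfg w ∈ E₂ x) (c := oneCfg w ∈ E₃ x) ?_ ?_ ?_
  · filter_upwards [pat] with ω hω; exact hE₁ hω
  · filter_upwards [pat] with ω hω; exact hE₂ hω
  · filter_upwards [pat] with ω hω; exact hE₃ hω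

/-- **Re-marking.**  Moving the terminal `i` to a vertex `z` of its weight-one component does not change `E₃` of local events
(the two markings have almost surely the same connectivity pattern). [this work] -/
theorem sahiE3_remark (hE₁ : IsLocal E₁) (hE₂ : IsLocal E₂) (hE₃ : IsLocal E₃)
    (w : Sym2 (Fin n) → unitInterval) (x : Fin k → Fin n) (i : Fin k) (z : Fin n)
    (hz : (openGraph (oneCfg w)).Reachable (x i) z) :
    sahiE3 (prodBernoulli w) (E₁ (Function.update x i z)) (E₂ (Function.update x i z)) (E₃ (Function.update x i z)) =
      sahiE3 (prodBernoulli w) (E₁ x) (E₂ x) (E₃ x) := by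
  have pat : ∀ᵐ ω ∂(prodBernoulli w), ∀ j l,
      (ω ∈ openConn (Function.update x i z j) (Function.update x i z l) ↔ ω ∈ openConn (x j) (x l)) := by
    filter_upwards [ae_good w] with ω hω
    have hiz : (openGraph ω).Reachable (x i) z := reachable_of_good hω hz
    have rel : ∀ j, (openGraph ω).Reachable (Function.update x i z j) (x j) := by
      intro j
      by_cases hj : j = i
      · subst hj
        rw [Function.update_self]
        exact hiz.symm
      · rw [Function.update_of_ne hj]
    intro j l
    show (openGraph ω).Reachable _ _ ↔ (openGraph ω).Reachable _ _
    exact ⟨fun h => ((rel j).symm.trans h).trans (rel l), fun h => ((rel j).trans h).trans (rel l).symm⟩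
  have hae : ∀ {E : (Fin k → Fin n) → Set (BondConfig (Fin n))}, IsLocal E →
      E (Function.update x i z) =ᵐ[prodBernoulli w] E x := by
    intro E hE
    refine Filter.eventuallyEq_set.2 ?_
    filter_upwards [pat] with ω hω
    exact hE hω
  exact sahiE3_congr_ae (hae hE₁) (hae hE₂) (hae hE₃)

/-! ### Non-diagonal fractional edges -/

/-- The non-diagonal edges whose weight lies strictly between `0` and `1` (a diagonal element `s(v,v)` of `Sym2` never affects the
open graph, so its weight is irrelevant). [this work] -/
def frac (w : Sym2 (Fin n) → unitInterval) : Finset (Sym2 (Fin n)) :=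
  Finset.univ.filter fun e => ¬ e.IsDiag ∧ (0 : ℝ) < w e ∧ (w e : ℝ) < 1

/-- A fractional edge between distinct vertices lies in `frac`. [this work] -/
theorem mem_frac {w : Sym2 (Fin n) → unitInterval} {z u : Fin n} (hzu : z ≠ u) (h0 : (0 : ℝ) < w s(z, u))
    (h1 : (w s(z, u) : ℝ) < 1) : s(z, u) ∈ frac w := by
  simp only [frac, Finset.mem_filter, Finset.mem_univ, true_and, Sym2.mk_isDiag_iff]
  exact ⟨hzu, h0, h1⟩

/-- Setting a fractional weight to `0` or `1` strictly decreases the number of fractional edges. [folklore] -/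
theorem card_frac_update_lt (w : Sym2 (Fin n) → unitInterval) {e : Sym2 (Fin n)} (he : e ∈ frac w) (v : unitInterval)
    (hv : v = 0 ∨ v = 1) : (frac (Function.update w e v)).card < (frac w).card := by
  have hsub : frac (Function.update w e v) ⊆ (frac w).erase e := by
    intro f hf
    simp only [frac, Finset.mem_filter, Finset.mem_univ, true_and] at hf
    rw [Finset.mem_erase]
    by_cases hfe : f = e
    · subst hfe
      rw [Function.update_self] at hf
      rcases hv with rfl | rfl
      · simp at hf
      · simp at hf
    · rw [Function.update_of_ne hfe] at hf
      exact ⟨hfe, by simp only [frac, Finset.mem_filter, Finset.mem_univ, true_and]; exact hf⟩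
  exact lt_of_le_of_lt (Finset.card_le_card hsub) (Finset.card_erase_lt_of_mem he)

/-- Moving one coordinate of an injective marking to a fresh vertex keeps it injective. [folklore] -/
theorem injective_update_of_forall_ne {x : Fin k → Fin n} (hx : Function.Injective x) {i : Fin k} {z : Fin n}
    (hz : ∀ j, x j ≠ z) : Function.Injective (Function.update x i z) := by
  intro j l h
  by_cases hj : j = i
  · subst hj
    by_cases hl : l = j
    · exact hl.symm
    · rw [Function.update_self, Function.update_of_ne hl] at h
      exact absurd h.symm (hz l)
  · by_cases hl : l = i
    · subst hl
      rw [Function.update_self, Function.update_of_ne hj] at h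
      exact absurd h (hz j)
    · rw [Function.update_of_ne hj, Function.update_of_ne hl] at h
      exact hx h

/-! ### The schema -/

/-- **The terminal-edge hypotheses** for three marking-indexed event families: for every weight function `w`, every INJECTIVE
marking `x` of the `k` terminals, every terminal `i` and every vertex `u ≠ x i` — writing `e = s(x i, u)`, `w⁰ = w[e ↦ 0]`,
`w¹ = w[e ↦ 1]` — the two polarised Bernstein coefficients of `E₃(E₁ x, E₂ x, E₃ x)` along `e` are nonnegative,
`0 ≤ polar₁ μ_{w⁰} μ_{w¹}` and `0 ≤ polar₁ μ_{w¹} μ_{w⁰}` (`EdgeInduction.polar₁`), GIVEN the induction hypotheses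
`0 ≤ E₃` under `w⁰` and under `w¹` at every injective marking.  Only edges AT A TERMINAL occur: for `u` unmarked these are cubic
forms in the law of the `k + 1` points `(x, u)` under `w⁰` (five points, 52 cells, when `k = 4`), for `u` a terminal in the law of
the `k` points. [this work] -/
def TerminalEdgeHyp (E₁ E₂ E₃ : (Fin k → Fin n) → Set (BondConfig (Fin n))) : Prop :=
  ∀ (w : Sym2 (Fin n) → unitInterval) (x : Fin k → Fin n), Function.Injective x → ∀ (i : Fin k) (u : Fin n), u ≠ x i →
    (∀ x' : Fin k → Fin n, Function.Injective x' →
        0 ≤ sahiE3 (prodBernoulli (Function.update w s(x i, u) 0)) (E₁ x') (E₂ x') (E₃ x') ∧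
        0 ≤ sahiE3 (prodBernoulli (Function.update w s(x i, u) 1)) (E₁ x') (E₂ x') (E₃ x')) →
    0 ≤ polar₁ (prodBernoulli (Function.update w s(x i, u) 0)) (prodBernoulli (Function.update w s(x i, u) 1))
        (E₁ x) (E₂ x) (E₃ x) ∧
    0 ≤ polar₁ (prodBernoulli (Function.update w s(x i, u) 1)) (prodBernoulli (Function.update w s(x i, u) 0))
        (E₁ x) (E₂ x) (E₃ x)

/-- **THE TERMINAL-EDGE INDUCTION SCHEMA.**  For three LOCAL marking-indexed event families, the terminal-edge hypotheses imply
`0 ≤ E₃(E₁ x, E₂ x, E₃ x)` under `prodBernoulli w` for EVERY weight function `w` and every injective marking `x`.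
Proof: induction on the number of non-diagonal fractional edges.  If some fractional edge `zu` has an end `z` in the weight-one
component of a terminal `x i`, re-mark `i ↦ z` (`sahiE3_remark`: same `E₃`), expand `E₃` as a Bernstein cubic in `w(zu)`
(`EdgeInduction.sahiE3_oneBond`) and use the induction hypotheses for `w[zu ↦ 0], w[zu ↦ 1]` and the terminal-edge hypotheses at
the terminal `z`; otherwise `E₃ = 0` (`sahiE3_eq_zero_of_not_touch`). [this work] -/
theorem sahiE3_nonneg_of_terminalEdgeHyp (hE₁ : IsLocal E₁) (hE₂ : IsLocal E₂) (hE₃ : IsLocal E₃)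
    (h : TerminalEdgeHyp E₁ E₂ E₃) (w : Sym2 (Fin n) → unitInterval) (x : Fin k → Fin n) (hx : Function.Injective x) :
    0 ≤ sahiE3 (prodBernoulli w) (E₁ x) (E₂ x) (E₃ x) := by
  suffices H : ∀ (m : ℕ) (w : Sym2 (Fin n) → unitInterval), (frac w).card ≤ m →
      ∀ x : Fin k → Fin n, Function.Injective x → 0 ≤ sahiE3 (prodBernoulli w) (E₁ x) (E₂ x) (E₃ x) from H _ w le_rfl x hx
  intro m
  induction m with
  | zero =>
      intro w hm x hx
      have hB : ¬ Touch w x := by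
        rintro ⟨z, u, -, hzu, h0, h1⟩
        have := Finset.card_pos.2 ⟨_, mem_frac hzu h0 h1⟩
        omega
      exact le_of_eq (sahiE3_eq_zero_of_not_touch hE₁ hE₂ hE₃ w x hB).symm
  | succ m ih =>
      intro w hm x hx
      -- the Bernstein step at a fractional edge `s(x j, u)` incident to the terminal `j`
      have step : ∀ (x : Fin k → Fin n), Function.Injective x → ∀ (j : Fin k) (u : Fin n), u ≠ x j →
          (0 : ℝ) < w s(x j, u) → (w s(x j, u) : ℝ) < 1 → 0 ≤ sahiE3 (prodBernoulli w) (E₁ x) (E₂ x) (E₃ x) := by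
        intro x hx j u hu h0 h1
        have he : s(x j, u) ∈ frac w := mem_frac hu.symm h0 h1
        have hc0 : (frac (Function.update w s(x j, u) 0)).card ≤ m :=
          Nat.lt_succ_iff.1 (lt_of_lt_of_le (card_frac_update_lt w he 0 (Or.inl rfl)) hm)
        have hc1 : (frac (Function.update w s(x j, u) 1)).card ≤ m :=
          Nat.lt_succ_iff.1 (lt_of_lt_of_le (card_frac_update_lt w he 1 (Or.inr rfl)) hm)
        have i0 := ih _ hc0 x hx
        have i1 := ih _ hc1 x hx
        obtain ⟨b1, b2⟩ := h w x hx j u hu (fun x' hx' => ⟨ih _ hc0 x' hx', ih _ hc1 x' hx'⟩)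
        have hp0 : (0 : ℝ) ≤ w s(x j, u) := (w s(x j, u)).2.1
        have hp1 : (w s(x j, u) : ℝ) ≤ 1 := (w s(x j, u)).2.2
        have hq : (0 : ℝ) ≤ 1 - w s(x j, u) := sub_nonneg.2 hp1
        rw [sahiE3_oneBond w s(x j, u) (E₁ x) (E₂ x) (E₃ x)]
        positivity
      by_cases hB : Touch w x
      · obtain ⟨z, u, ⟨i, hiz⟩, hzu, h0, h1⟩ := hB
        by_cases hzx : ∃ j, x j = z
        · obtain ⟨j, rfl⟩ := hzx
          exact step x hx j u hzu.symm h0 h1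
        · have hzx' : ∀ j, x j ≠ z := fun j hj => hzx ⟨j, hj⟩
          rw [← sahiE3_remark hE₁ hE₂ hE₃ w x i z hiz]
          refine step _ (injective_update_of_forall_ne hx hzx') i u ?_ ?_ ?_
          · rw [Function.update_self]; exact hzu.symm
          · rw [Function.update_self]; exact h0
          · rw [Function.update_self]; exact h1
      · exact le_of_eq (sahiE3_eq_zero_of_not_touch hE₁ hE₂ hE₃ w x hB).symm

/-- **Pattern-predicate form.**  For three `k`-terminal pattern predicates `Φ₁ Φ₂ Φ₃` (Boolean functions of the `k × k`
connectivity matrix of the terminals) the terminal-edge hypotheses give `E₃ ≥ 0` at every injective marking of every finite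
weighted graph. [this work] -/
theorem sahiE3_pattern_nonneg_of_terminalEdgeHyp (Φ₁ Φ₂ Φ₃ : (Fin k → Fin k → Bool) → Bool)
    (h : TerminalEdgeHyp (fun x : Fin k → Fin n => connEvent (fun r => Φ₁ (fun i j => r (x i) (x j))))
      (fun x => connEvent (fun r => Φ₂ (fun i j => r (x i) (x j)))) (fun x => connEvent (fun r => Φ₃ (fun i j => r (x i) (x j)))))
    (w : Sym2 (Fin n) → unitInterval) (x : Fin k → Fin n) (hx : Function.Injective x) :
    0 ≤ sahiE3 (prodBernoulli w) (connEvent (fun r => Φ₁ (fun i j => r (x i) (x j))))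
      (connEvent (fun r => Φ₂ (fun i j => r (x i) (x j)))) (connEvent (fun r => Φ₃ (fun i j => r (x i) (x j)))) :=
  sahiE3_nonneg_of_terminalEdgeHyp (isLocal_connEvent Φ₁) (isLocal_connEvent Φ₂) (isLocal_connEvent Φ₃) h w x hx

end TerminalEdgeInduction

end Summit.CriticalPhenomena.PercolationContinuityZ3.Theorems
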